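import Mathlib
import HarnessLib
import Summits.Ventures.LatticeQCDFlow.Exactness.FlowPushforward

/-!
# The inverse pass of an exact invertible layer is exact, with the reciprocal of the forward density read at the preimage

HONEST FRAMING: exact (Metropolis-corrected) sampling algorithms for lattice gauge theory;
figures of merit are autocorrelation/cost numbers at stated couplings and volumes; no
continuum-physics claim.

Venture `LatticeQCDFlow` (cell pub-lqcd), topic `Exactness`; FANOUT row 10 (`eng-equiv`, engine
`latflow.equiv`: every layer ships `inverse=True` — `splines.rqs_inverse`, `spectral.spectral_kernel(…,
inverse=True)` ("LDJ is log|det| of the map APPLIED … inverse: h⁻¹ — so forward LDJ = −inverse LDJ at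
corresponding points"), `residual.ResidualCoupling.inverse`; the acceptance test "invertibility round-trip").
NEW WORK of the cell over `FlowPushforward` (`HasJacobian`, `map_withDensity_comp_eq`) and Mathlib only.
A purely measure-theoretic statement: if a measurable AUTOMORPHISM `F` has `HasJacobian vol F J` with
`J` pointwise nonzero and finite, then `F⁻¹` has `HasJacobian vol F⁻¹ (1/J ∘ F⁻¹)` — what the engine
books on the inverse pass.  Nothing is cited as a fact; no number; no definition.

* **`HasJacobian.symm`** (dot-notation on the tree's `HasJacobian`) — `HasJacobian vol F J`, `J ≠ 0, ∞`
  ⟹ `HasJacobian vol F.symm (fun x => (J (F.symm x))⁻¹)`;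
* `HasJacobian.symm_ofReal` — the same for a real density `j > 0` booked as `ofReal ∘ j`:
  `HasJacobian vol F.symm (fun x => ofReal (j (F.symm x))⁻¹)`;
Instances: every layer of rows 10 / 14 typed as a measurable automorphism with `HasJacobian`
(`PlaquetteKernelLayerEquiv`, `U1SplinePlaquetteCouplingEquiv`, `U1DegreeOnePlaquetteCouplingLayer`,
`LocationCouplingLayerEquiv`, `DegreeOneLayerEquiv`, `NCPLayerEquiv`, …).
-/

noncomputable section

namespace Summit.Ventures.LatticeQCDFlow.Exactness

open MeasureTheory
open scoped ENNReal

variable {Ω : Type*} [MeasurableSpace Ω] {vol : Measure Ω} {J : Ω → ℝ≥0∞}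

/-- **The inverse of an exact automorphism is exact with the reciprocal density at the preimage.**
If `F : Ω ≃ᵐ Ω` has `HasJacobian vol F J` (`F_*(J·vol) = vol`) with `J` nowhere `0` or `∞`, then
`HasJacobian vol F.symm (x ↦ (J (F.symm x))⁻¹)`.  Proof: `J⁻¹∘F⁻¹ · vol = J⁻¹∘F⁻¹ · F_*(J·vol) =
F_*((J⁻¹∘F⁻¹∘F)·J·vol) = F_*(vol)`, and `F⁻¹_* F_* vol = vol`. -/
theorem HasJacobian.symm {F : Ω ≃ᵐ Ω} (h : HasJacobian vol F J) (hJ0 : ∀ z, J z ≠ 0)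
    (hJtop : ∀ z, J z ≠ ∞) : HasJacobian vol F.symm fun x => (J (F.symm x))⁻¹ := by
  have hJm : Measurable J := h.measurable_jac
  have hinvm : Measurable fun x => (J (F.symm x))⁻¹ := (hJm.comp F.symm.measurable).inv
  refine ⟨F.symm.measurable, hinvm, ?_⟩
  -- rewrite `vol` as `F_*(J·vol)` under the density, pull the density through the push-forward
  have h1 : vol.withDensity (fun x => (J (F.symm x))⁻¹) =
      Measure.map F ((vol.withDensity J).withDensity fun z => (J (F.symm (F z)))⁻¹) := by
    conv_lhs => rw [← h.map_eq]
    rw [map_withDensity_comp_eq F.measurable hinvm]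
  have h2 : ((vol.withDensity J).withDensity fun z => (J (F.symm (F z)))⁻¹) = vol := by
    have e : (fun z => (J (F.symm (F z)))⁻¹) = fun z => (J z)⁻¹ := by
      funext z; rw [MeasurableEquiv.symm_apply_apply]
    rw [e]
    change (vol.withDensity J).withDensity J⁻¹ = vol
    rw [← withDensity_mul _ hJm hJm.inv]
    have e2 : (J * J⁻¹) = 1 := by
      funext z
      simp only [Pi.mul_apply, Pi.inv_apply, Pi.one_apply]
      exact ENNReal.mul_inv_cancel (hJ0 z) (hJtop z)
    rw [e2, withDensity_one]
  rw [h1, h2, MeasurableEquiv.map_symm_map]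

/-- The same for a positive real density booked as `ofReal ∘ j` (the engine books `−ldj` on the
inverse pass): `HasJacobian vol F.symm (x ↦ ofReal (j (F.symm x))⁻¹)`. -/
theorem HasJacobian.symm_ofReal {F : Ω ≃ᵐ Ω} {j : Ω → ℝ} (h : HasJacobian vol F fun z => ENNReal.ofReal (j z))
    (hj : ∀ z, 0 < j z) : HasJacobian vol F.symm fun x => ENNReal.ofReal (j (F.symm x))⁻¹ := by
  have h' := h.symm (fun z => (ENNReal.ofReal_pos.mpr (hj z)).ne') (fun z => ENNReal.ofReal_ne_top)
  have e : (fun x => ENNReal.ofReal (j (F.symm x))⁻¹) = fun x => (ENNReal.ofReal (j (F.symm x)))⁻¹ :=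
    funext fun x => ENNReal.ofReal_inv_of_pos (hj _)
  rw [e]
  exact h'

end Summit.Ventures.LatticeQCDFlow.Exactness
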